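/-
Copyright (c) 2026 the pub-hodgecm-mathlib formalisation cell (harness21).  Prover seat hodgecm-mathlib-LH4-p09 (g8), req620 Track A «(D-RAM) FOUR-FRAME» squad
(heir dealer LH4-plan (g13) WORD #58 RULING C — (T-G-on) organs).  2026-09-04.
-/
import Summits.HodgeConjecture.HodgeConjecture.Theorems.F0P3cDyRamLabelledKappaCoreHangingLocus   -- (this seat) K2: R-currency heads + vacuous regime; brings ★ κH socket, ★ κH-B1 character sums, ★ p859628
import HarnessLib

/-!
# (D-RAM) four-frame, STAGE 1b — (S2b-κS) organ (T-G-on | H), continued: the labelled κ-count on `H (2ρ, 2ρ, 2ρ)` on the cancellation locus — the GENUINE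
# regime `k < ℓ + 2ρ` in CLOSED FORM (character sums over the token ball by ★ κH-B1), tube and equilateral foot

Helper brick for dealer LH4-plan (g13) WORD #58 RULING C ((T-G-on) = this seat, 11:20Z): `Theorems/` only, statement-first, ★-only imports, lane
`--supports stmt-HodgeConjecture-24833 --as helper`; it PAYS NO tier-0 row (count-neutral).

THE CLOSED FORMS (`v(e₂−e₀) = v(e₂−e₁) = k`, genuine `k < ℓ + 2ρ`, `E = ℓ + 2ρ − k ≥ 1`; `g_e = (e₂−e₁)∕(e₂−e₀)`, `g₀ = (β−1)∕(α−1)`, `χᴴᵢ(f) = (ω(−(1+f)), ω(f)ω(−(1+f)), ω(f))ᵢ`).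
TUBE (`2ρ ≤ n₁, n₂`, `ρ ≤ n₃`): with a fixed witness `f₀`, `|f₀ + g_e| ≤ |ϖ|^E`:
`Σᶠ_{M ∈ H, diag(e)M ⊆ ϖ^ℓM} κᵢ(M)·w(M) = [outer] · [|e₁−e₀| = |ϖ|^k ∧ 2d−1 ≤ E] · χᴴᵢ(f₀) · q^{2ρ−⌈E∕2⌉}` — the token ball is all-admissible iff `|e₁−e₀| = |ϖ|^k` (★ p859628),
its character sum is `#ball·χᴴᵢ(f₀)` when `2d−1 ≤ E` (★ `finsum_chiH_glue_eq_ncard_mul`) and `0` when `E ≤ 2d−2` (★ `finsum_chiH_glue_eq_zero`, or the orbit guard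
`2d−1 ≤ ρ` fails); without a fixed witness the index set is empty and the sum is `0`.
FOOT (`n₁ = n₂ = n₃ = m`, `ρ ≤ m < 2ρ`, `e₀ = 2ρ−m`): with a fixed witness in BOTH balls the balls are nested and the sum is
`[outer] · [2d−1 ≤ max(e₀,E)] · χᴴᵢ(f₀) · q^{2ρ−⌈max(e₀,E)∕2⌉}`; with no fixed point in both, `0`.  For the token of record `e = ((α−1)², (β−1)², 0)` on an equilateral
datum `g_e = g₀²` and `|g₀ − g₀²| = |1 − g₀| = 1`: no point lies in both balls, so the genuine foot regime contributes `0`.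

* §1 **`finsum_kappaCount_mul_stabiliserWeight_stratum_H_sep_onLocus_tube_of_witness`**, **`…_tube_of_no_witness`**.
* §2 **`finsum_kappaCount_mul_stabiliserWeight_stratum_H_sep_onLocus_foot_of_witness`**, **`…_foot_of_no_witness`**.

HONEST LABEL: helper organs for a HYPOTHESIS (★ p859650 `hTrunk`); STAGE-1b tier-0 rows T₊∕T₋∕regular and the six ED. 5 stubs stay OPEN; HC_CM is proved only
modulo the 7 printed citations (2 remaining named inputs: hLiu418 = `stmt-HodgeConjecture-24832`, h413 = `stmt-HodgeConjecture-24833`) until rung 0 closes.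

## References
* [Kottwitz1986BaseChangeUnits] R. E. Kottwitz, *Base change for unit elements of Hecke algebras*, Compositio Math. 60 (1986), §1 pp. 240–241 (κ-orbital integrals of units as signed lattice counts modulo the torus).
* [LanglandsShelstad1987] R. P. Langlands, D. Shelstad, *On the definition of transfer factors*, Math. Ann. 278 (1987), §3 (κ as a character).
* [Rogawski1990] J. D. Rogawski, *Automorphic Representations of Unitary Groups in Three Variables*, Ann. of Math. Stud. 123 (1990), §4.9 Prop. 4.9.1 (a) p. 55.
* [Serre1979] J.-P. Serre, *Local Fields*, GTM 67 (1979), Ch. IV §2 Prop. 6; Ch. V §3 Prop. 5, Cor. 3 (unit filtration counts, norm residue symbol).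
-/

set_option autoImplicit false

noncomputable section

namespace Summit.HodgeConjecture.HodgeConjecture.Cruxes.H413.F0P3cDyRamLabelledKappaCoreHangingLocusClosed

open Matrix WithZero
open Literature.NumberTheory.Automorphic Literature.NumberTheory.Automorphic.HermitianLattice Literature.NumberTheory.Automorphic.UnitaryGroup
open Literature.NumberTheory.Automorphic.UnitaryLatticeTree Literature.NumberTheory.Automorphic.UnitaryThreeFourFrame
open Literature.NumberTheory.LocalFields.WildQuadraticDatum
open Summit.HodgeConjecture.HodgeConjecture.Cruxes.H413.F0P3cDyRamDiagonalTorusDefs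
open Summit.HodgeConjecture.HodgeConjecture.Cruxes.H413.F0P3cDyRamDiagonalStrataDefs
open Summit.HodgeConjecture.HodgeConjecture.Cruxes.H413.F0P3cDyRamDiagonalKappaCountDefs
open Summit.HodgeConjecture.HodgeConjecture.Cruxes.H413.F0P3cDyRamDiagonalGluedStabiliserIndex (ne_zero_and_v_lt_one_of_v_eq_exp)
open Summit.HodgeConjecture.HodgeConjecture.Cruxes.H413.F0P3cDyRamDiagonalGluedStabiliserMembership (pow_mul_le_pow_add_iff)
open Summit.HodgeConjecture.HodgeConjecture.Cruxes.H413.F0P3cDyRamDiagonalGluedClassRepresentatives (exists_fixed_class_representatives)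
open Summit.HodgeConjecture.HodgeConjecture.Cruxes.H413.F0P3cDyRamDiagonalCoreHangingFoot (ncard_glue_representatives_eq)
open Summit.HodgeConjecture.HodgeConjecture.Cruxes.H413.F0P3cDyRamDiagonalKappaCoreHangingCharacterSums (finsum_chiH_glue_eq_zero finsum_chiH_glue_eq_ncard_mul)
open Summit.HodgeConjecture.HodgeConjecture.Cruxes.H413.F0P3cDyRamDiagonalKappaCoreHangingSocket (v_glueUnit_letters)
open Summit.HodgeConjecture.HodgeConjecture.Cruxes.H413.F0P3cDyRamFourFrameCensusDefs
open Summit.HodgeConjecture.HodgeConjecture.Cruxes.H413.F0P3cDyRamLabelledGluedLocusCensusFoot (ball_of_witness)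
open Summit.HodgeConjecture.HodgeConjecture.Cruxes.H413.F0P3cDyRamLabelledCoreHangingLocusCensusClosed (one_sub_glueRatio_eq v_one_add_eq_one_of_ball v_one_add_lt_one_of_ball)
open Summit.HodgeConjecture.HodgeConjecture.Cruxes.H413.F0P3cDyRamLabelledKappaCoreHangingLocus
open scoped Valued WithZero Matrix MatrixGroups

variable {K : Type} [Field K] [Valued K ℤᵐ⁰] [CompleteSpace K] [Fintype 𝓀[K]] {σ : K →+* K} {ϖ : K} {d t : ℕ} {α β : K} {N₀ n₁ n₂ n₃ : ℕ}
  {T : GL (Fin 3) K}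

/-! ## §1  Tube, genuine regime -/

open Classical in
/-- **HEAD — LABELLED κ-WEIGHTED H SUM, TUBE, GENUINE REGIME, WITH A FIXED WITNESS** (`2ρ ≤ n₁, n₂`, `ρ ≤ n₃`; `v(e₂−e₀) = v(e₂−e₁) = k < ℓ + 2ρ`,
`E = ℓ + 2ρ − k`; `σ f₀ = f₀`, `|f₀ + g_e| ≤ |ϖ|^E`): `Σᶠ_{M ∈ H, diag(e)M ⊆ ϖ^ℓM} κᵢ(M)·w(M) = [outer] · [|e₁−e₀| = |ϖ|^k ∧ 2d−1 ≤ E] · χᴴᵢ(f₀) · q^{2ρ−⌈E∕2⌉}`.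
[cite: Kottwitz1986BaseChangeUnits, §1 pp. 240–241] [cite: LanglandsShelstad1987, §3] [cite: Serre1979, Ch. V §3 Prop. 5, Cor. 3] [cite: Rogawski1990, §4.9 Prop. 4.9.1 (a) p. 55] -/
theorem finsum_kappaCount_mul_stabiliserWeight_stratum_H_sep_onLocus_tube_of_witness (hD : IsRamifiedQuadraticDatum σ ϖ d t) (h2 : Valued.v (2 : K) < 1)
    (hE : IsElementDatum σ ϖ N₀ α β n₁ n₂ n₃) (hT : (T : Matrix (Fin 3) (Fin 3) K) = Matrix.diagonal ![α, β, 1])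
    (ρ : ℕ) (hρ : 1 ≤ ρ) (htube : 2 * ρ ≤ n₁ ∧ 2 * ρ ≤ n₂) (hn₃ : ρ ≤ n₃) (i : Fin 3) (ℓ k : ℕ) (e : Fin 3 → K)
    (hk : Valued.v (e 2 - e 0) = Valued.v ϖ ^ k) (hloc : Valued.v (e 2 - e 1) = Valued.v ϖ ^ k) (hgen : k < ℓ + 2 * ρ)
    {f₀ : K} (hσf₀ : σ f₀ = f₀) (hf₀ : Valued.v (f₀ + (e 2 - e 1) / (e 2 - e 0)) ≤ Valued.v ϖ ^ (ℓ + 2 * ρ - k)) :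
    ∑ᶠ M ∈ {M | M ∈ stratum σ ϖ T ![2 * ρ, 2 * ρ, 2 * ρ] ∧ LatticeInLevel ϖ ℓ (Matrix.diagonal e) M},
        (kappaCount σ ϖ 0 i M : ℚ) * stabiliserWeight σ M =
      if ((Valued.v (e 0) ≤ Valued.v ϖ ^ ℓ ∧ Valued.v (e 1) ≤ Valued.v ϖ ^ ℓ ∧ Valued.v (e 2) ≤ Valued.v ϖ ^ ℓ) ∧
          Valued.v (e 1 - e 0) ≤ Valued.v ϖ ^ (ℓ + ρ)) ∧ ℓ + ρ ≤ k then
        (if Valued.v (e 1 - e 0) = Valued.v ϖ ^ k ∧ 2 * d - 1 ≤ ℓ + 2 * ρ - k then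
            (((![normSign σ (-(1 + f₀)), normSign σ f₀ * normSign σ (-(1 + f₀)), normSign σ f₀] : Fin 3 → ℤ) i : ℤ) : ℚ) *
              (Fintype.card 𝓀[K] : ℚ) ^ (2 * ρ - (ℓ + 2 * ρ - k + 1) / 2)
          else 0)
      else 0 := by
  classical
  have hσ : ∀ x, σ (σ x) = x := hD.1
  have hvσ : ∀ a, Valued.v (σ a) = Valued.v a := hD.2.1
  have hϖ : Valued.v ϖ = exp (-1 : ℤ) := hD.2.2.1
  have hfix : ∀ x : K, σ x = x → x ≠ 0 → ∃ n : ℤ, Valued.v x = exp (2 * n) := hD.2.2.2.1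
  have hd : Valued.v (ϖ - σ ϖ) = Valued.v ϖ ^ d := hD.2.2.2.2.1
  obtain ⟨hϖ0, hϖ1⟩ := ne_zero_and_v_lt_one_of_v_eq_exp hϖ
  have hvϖ0 : Valued.v ϖ ≠ 0 := (Valuation.ne_zero_iff _).2 hϖ0
  have he : e 2 - e 0 ≠ 0 := fun h => by rw [h, map_zero] at hk; exact pow_ne_zero k hvϖ0 hk.symm
  have hge : Valued.v ((e 2 - e 1) / (e 2 - e 0)) = 1 := by rw [map_div₀, hk, hloc, div_self (pow_ne_zero k hvϖ0)]
  obtain ⟨R, hRfin, -, hR1, hR2, hR3⟩ := exists_fixed_class_representatives hσ hvσ hfix hϖ hd ρ 0 hρ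
  simp only [Nat.mul_zero, pow_zero, Nat.add_zero] at hR1 hR2 hR3
  rw [finsum_kappaCount_mul_stabiliserWeight_stratum_H_sep_onLocus_tube_eq hD h2 hE hT ρ hρ htube hn₃ i ℓ k e hk hloc hRfin hR1 hR2 hR3]
  by_cases hout : ((Valued.v (e 0) ≤ Valued.v ϖ ^ ℓ ∧ Valued.v (e 1) ≤ Valued.v ϖ ^ ℓ ∧ Valued.v (e 2) ≤ Valued.v ϖ ^ ℓ) ∧
      Valued.v (e 1 - e 0) ≤ Valued.v ϖ ^ (ℓ + ρ)) ∧ ℓ + ρ ≤ k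
  · rw [if_pos hout, if_pos hout, ← Nat.card_eq_fintype_card]
    have hEeq : ℓ + 2 * ρ = k + (ℓ + 2 * ρ - k) := by omega
    -- the index set is the token ball of exponent `E`, with the admissibility conjunct
    have hball : {g : K | g ∈ R ∧ Valued.v (1 + g) = 1 ∧ Valued.v ϖ ^ k * Valued.v (g + (e 2 - e 1) / (e 2 - e 0)) ≤ Valued.v ϖ ^ (ℓ + 2 * ρ)} =
        {g : K | g ∈ R ∧ Valued.v (1 + g) = 1 ∧ Valued.v (g + (e 2 - e 1) / (e 2 - e 0)) ≤ Valued.v ϖ ^ (ℓ + 2 * ρ - k)} :=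
      Set.ext fun g => and_congr_right fun _ => and_congr_right fun _ => by
        rw [hEeq, pow_mul_le_pow_add_iff hϖ0, Nat.add_sub_cancel_left]
    rw [hball]
    by_cases h10 : Valued.v (e 1 - e 0) = Valued.v ϖ ^ k
    · -- all-admissible ball
      have h1ge : Valued.v (1 - (e 2 - e 1) / (e 2 - e 0)) = 1 := by
        rw [one_sub_glueRatio_eq he, map_div₀, h10, hk, div_self (pow_ne_zero k hvϖ0)]
      have hadm : {g : K | g ∈ R ∧ Valued.v (1 + g) = 1 ∧ Valued.v (g + (e 2 - e 1) / (e 2 - e 0)) ≤ Valued.v ϖ ^ (ℓ + 2 * ρ - k)} =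
          {g : K | g ∈ R ∧ Valued.v (g + (e 2 - e 1) / (e 2 - e 0)) ≤ Valued.v ϖ ^ (ℓ + 2 * ρ - k)} :=
        Set.ext fun g => ⟨fun h => ⟨h.1, h.2.2⟩, fun h => ⟨h.1, v_one_add_eq_one_of_ball hϖ0 hϖ1 (by omega) hk h10 h.2, h.2⟩⟩
      rw [hadm]
      by_cases hdE : 2 * d - 1 ≤ ℓ + 2 * ρ - k
      · rw [if_pos ⟨h10, hdE⟩]
        have hdρ : 2 * d - 1 ≤ ρ := by omega
        simp only [if_pos hdρ]
        rw [finsum_chiH_glue_eq_ncard_mul hD hRfin hR1 hge h1ge hdE hσf₀ hf₀ i,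
          ncard_glue_representatives_eq hσ hvσ hfix hϖ hd (by omega) (by omega) hRfin hR1 hR2 hR3 hge hσf₀ hf₀,
          show 2 * ρ - (ℓ + 2 * ρ - k + 1) / 2 = (ρ + 1) / 2 - (ℓ + 2 * ρ - k + 1) / 2 + (ρ + ρ / 2) by omega, pow_add]
        push_cast
        ring
      · rw [if_neg (fun h => hdE h.2)]
        by_cases hdρ : 2 * d - 1 ≤ ρ
        · simp only [if_pos hdρ]
          rw [finsum_chiH_glue_eq_zero hD h2 hdρ hRfin hR1 hR2 hR3 hge h1ge (by omega) (by omega) (by omega) i, zero_mul]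
        · simp only [if_neg hdρ, Int.cast_zero]
          rw [show (∑ᶠ g ∈ {g : K | g ∈ R ∧ Valued.v (g + (e 2 - e 1) / (e 2 - e 0)) ≤ Valued.v ϖ ^ (ℓ + 2 * ρ - k)}, (0 : ℚ)) = 0 by simp, zero_mul]
    · -- all-inadmissible ball: empty index set
      have hemp : {g : K | g ∈ R ∧ Valued.v (1 + g) = 1 ∧ Valued.v (g + (e 2 - e 1) / (e 2 - e 0)) ≤ Valued.v ϖ ^ (ℓ + 2 * ρ - k)} = ∅ :=
        Set.eq_empty_of_forall_notMem fun g ⟨_, h1g, hg⟩ => (v_one_add_lt_one_of_ball hϖ0 hϖ1 (by omega) hk hloc h10 hg).ne h1g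
      rw [if_neg (fun h => h10 h.1), hemp, finsum_mem_empty, zero_mul]
  · rw [if_neg hout, if_neg hout]

/-- **HEAD — LABELLED κ-WEIGHTED H SUM, TUBE, GENUINE REGIME, NO FIXED WITNESS**: if no `σ`-fixed `f` has `|f + g_e| ≤ |ϖ|^{ℓ+2ρ−k}` (`k < ℓ + 2ρ`), the index set is empty
(members of `R` are fixed) and the label-cut κ-sum is `0`. [cite: Kottwitz1986BaseChangeUnits, §1 pp. 240–241] [cite: LanglandsShelstad1987, §3] -/
theorem finsum_kappaCount_mul_stabiliserWeight_stratum_H_sep_onLocus_tube_of_no_witness (hD : IsRamifiedQuadraticDatum σ ϖ d t) (h2 : Valued.v (2 : K) < 1)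
    (hE : IsElementDatum σ ϖ N₀ α β n₁ n₂ n₃) (hT : (T : Matrix (Fin 3) (Fin 3) K) = Matrix.diagonal ![α, β, 1])
    (ρ : ℕ) (hρ : 1 ≤ ρ) (htube : 2 * ρ ≤ n₁ ∧ 2 * ρ ≤ n₂) (hn₃ : ρ ≤ n₃) (i : Fin 3) (ℓ k : ℕ) (e : Fin 3 → K)
    (hk : Valued.v (e 2 - e 0) = Valued.v ϖ ^ k) (hloc : Valued.v (e 2 - e 1) = Valued.v ϖ ^ k) (hgen : k < ℓ + 2 * ρ)
    (hno : ¬ ∃ f : K, σ f = f ∧ Valued.v (f + (e 2 - e 1) / (e 2 - e 0)) ≤ Valued.v ϖ ^ (ℓ + 2 * ρ - k)) :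
    ∑ᶠ M ∈ {M | M ∈ stratum σ ϖ T ![2 * ρ, 2 * ρ, 2 * ρ] ∧ LatticeInLevel ϖ ℓ (Matrix.diagonal e) M},
        (kappaCount σ ϖ 0 i M : ℚ) * stabiliserWeight σ M = 0 := by
  classical
  have hσ : ∀ x, σ (σ x) = x := hD.1
  have hvσ : ∀ a, Valued.v (σ a) = Valued.v a := hD.2.1
  have hϖ : Valued.v ϖ = exp (-1 : ℤ) := hD.2.2.1
  have hfix : ∀ x : K, σ x = x → x ≠ 0 → ∃ n : ℤ, Valued.v x = exp (2 * n) := hD.2.2.2.1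
  have hd : Valued.v (ϖ - σ ϖ) = Valued.v ϖ ^ d := hD.2.2.2.2.1
  obtain ⟨hϖ0, -⟩ := ne_zero_and_v_lt_one_of_v_eq_exp hϖ
  obtain ⟨R, hRfin, -, hR1, hR2, hR3⟩ := exists_fixed_class_representatives hσ hvσ hfix hϖ hd ρ 0 hρ
  simp only [Nat.mul_zero, pow_zero, Nat.add_zero] at hR1 hR2 hR3
  rw [finsum_kappaCount_mul_stabiliserWeight_stratum_H_sep_onLocus_tube_eq hD h2 hE hT ρ hρ htube hn₃ i ℓ k e hk hloc hRfin hR1 hR2 hR3]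
  by_cases hout : ((Valued.v (e 0) ≤ Valued.v ϖ ^ ℓ ∧ Valued.v (e 1) ≤ Valued.v ϖ ^ ℓ ∧ Valued.v (e 2) ≤ Valued.v ϖ ^ ℓ) ∧
      Valued.v (e 1 - e 0) ≤ Valued.v ϖ ^ (ℓ + ρ)) ∧ ℓ + ρ ≤ k
  · rw [if_pos hout]
    have hEeq : ℓ + 2 * ρ = k + (ℓ + 2 * ρ - k) := by omega
    have hemp : {g : K | g ∈ R ∧ Valued.v (1 + g) = 1 ∧ Valued.v ϖ ^ k * Valued.v (g + (e 2 - e 1) / (e 2 - e 0)) ≤ Valued.v ϖ ^ (ℓ + 2 * ρ)} = ∅ :=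
      Set.eq_empty_of_forall_notMem fun g ⟨hgR, _, hg⟩ => hno ⟨g, (hR1 g hgR).1, by
        rwa [hEeq, pow_mul_le_pow_add_iff hϖ0] at hg⟩
    rw [hemp, finsum_mem_empty, zero_mul]
  · rw [if_neg hout]

/-! ## §2  Equilateral foot, genuine regime -/

open Classical in
/-- **HEAD — LABELLED κ-WEIGHTED H SUM, EQUILATERAL FOOT, GENUINE REGIME, WITH A FIXED WITNESS IN BOTH BALLS** (`n₁ = n₂ = n₃ = m`, `ρ ≤ m < 2ρ`, `e₀ = 2ρ − m`;
`v(e₂−e₀) = v(e₂−e₁) = k < ℓ + 2ρ`, `E = ℓ + 2ρ − k`; `σ f₀ = f₀`, `|f₀ + g₀| ≤ |ϖ|^{e₀}`, `|f₀ + g_e| ≤ |ϖ|^E`):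
`Σᶠ_{M ∈ H, diag(e)M ⊆ ϖ^ℓM} κᵢ(M)·w(M) = [outer] · [2d−1 ≤ max(e₀, E)] · χᴴᵢ(f₀) · q^{2ρ−⌈max(e₀,E)∕2⌉}` — the two balls are nested (§ `ball_of_witness`), both all-admissible.
[cite: Kottwitz1986BaseChangeUnits, §1 pp. 240–241] [cite: LanglandsShelstad1987, §3] [cite: Serre1979, Ch. V §3 Prop. 5, Cor. 3] [cite: Rogawski1990, §4.9 Prop. 4.9.1 (a) p. 55] -/
theorem finsum_kappaCount_mul_stabiliserWeight_stratum_H_sep_onLocus_foot_of_witness (hD : IsRamifiedQuadraticDatum σ ϖ d t) (h2 : Valued.v (2 : K) < 1)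
    (hE : IsElementDatum σ ϖ N₀ α β n₁ n₂ n₃) (hT : (T : Matrix (Fin 3) (Fin 3) K) = Matrix.diagonal ![α, β, 1])
    (ρ : ℕ) (hρ : 1 ≤ ρ) (h12 : n₁ = n₂) (h13 : n₁ = n₃) (hρm : ρ ≤ n₁) (hm : n₁ < 2 * ρ) (i : Fin 3) (ℓ k : ℕ) (e : Fin 3 → K)
    (hk : Valued.v (e 2 - e 0) = Valued.v ϖ ^ k) (hloc : Valued.v (e 2 - e 1) = Valued.v ϖ ^ k) (hgen : k < ℓ + 2 * ρ)
    {f₀ : K} (hσf₀ : σ f₀ = f₀) (hf₀ : Valued.v (f₀ + (β - 1) / (α - 1)) ≤ Valued.v ϖ ^ (2 * ρ - n₁))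
    (hf₀' : Valued.v (f₀ + (e 2 - e 1) / (e 2 - e 0)) ≤ Valued.v ϖ ^ (ℓ + 2 * ρ - k)) :
    ∑ᶠ M ∈ {M | M ∈ stratum σ ϖ T ![2 * ρ, 2 * ρ, 2 * ρ] ∧ LatticeInLevel ϖ ℓ (Matrix.diagonal e) M},
        (kappaCount σ ϖ 0 i M : ℚ) * stabiliserWeight σ M =
      if ((Valued.v (e 0) ≤ Valued.v ϖ ^ ℓ ∧ Valued.v (e 1) ≤ Valued.v ϖ ^ ℓ ∧ Valued.v (e 2) ≤ Valued.v ϖ ^ ℓ) ∧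
          Valued.v (e 1 - e 0) ≤ Valued.v ϖ ^ (ℓ + ρ)) ∧ ℓ + ρ ≤ k then
        (if 2 * d - 1 ≤ max (2 * ρ - n₁) (ℓ + 2 * ρ - k) then
            (((![normSign σ (-(1 + f₀)), normSign σ f₀ * normSign σ (-(1 + f₀)), normSign σ f₀] : Fin 3 → ℤ) i : ℤ) : ℚ) *
              (Fintype.card 𝓀[K] : ℚ) ^ (2 * ρ - (max (2 * ρ - n₁) (ℓ + 2 * ρ - k) + 1) / 2)
          else 0)
      else 0 := by
  classical
  have hσ : ∀ x, σ (σ x) = x := hD.1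
  have hvσ : ∀ a, Valued.v (σ a) = Valued.v a := hD.2.1
  have hϖ : Valued.v ϖ = exp (-1 : ℤ) := hD.2.2.1
  have hfix : ∀ x : K, σ x = x → x ≠ 0 → ∃ n : ℤ, Valued.v x = exp (2 * n) := hD.2.2.2.1
  have hd : Valued.v (ϖ - σ ϖ) = Valued.v ϖ ^ d := hD.2.2.2.2.1
  have h₁ : Valued.v (β - 1) = Valued.v ϖ ^ n₁ := hE.2.2.2.2.2.1
  have h₂ : Valued.v (α - 1) = Valued.v ϖ ^ n₁ := by rw [h12]; exact hE.2.2.2.2.2.2.1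
  have h₃ : Valued.v (β - α) = Valued.v ϖ ^ n₁ := by rw [Valuation.map_sub_swap, h13]; exact hE.2.2.2.2.2.2.2.1
  obtain ⟨hϖ0, hϖ1⟩ := ne_zero_and_v_lt_one_of_v_eq_exp hϖ
  have hvϖ0 : Valued.v ϖ ≠ 0 := (Valuation.ne_zero_iff _).2 hϖ0
  obtain ⟨hg₀, h1g₀⟩ := v_glueUnit_letters hϖ0 h₁ h₂ h₃
  have hge : Valued.v ((e 2 - e 1) / (e 2 - e 0)) = 1 := by rw [map_div₀, hk, hloc, div_self (pow_ne_zero k hvϖ0)]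
  -- `|1 − g_e| = 1`: the two centres are closer than `1`
  have h1ge : Valued.v (1 - (e 2 - e 1) / (e 2 - e 0)) = 1 := by
    have hlt : Valued.v ((f₀ + (β - 1) / (α - 1)) - (f₀ + (e 2 - e 1) / (e 2 - e 0))) < Valued.v (1 - (β - 1) / (α - 1)) := by
      rw [h1g₀]
      exact (Valuation.map_sub _ _ _).trans_lt
        (max_lt (hf₀.trans_lt (pow_lt_one₀ zero_le hϖ1 (by omega))) (hf₀'.trans_lt (pow_lt_one₀ zero_le hϖ1 (by omega))))
    rw [show (1 : K) - (e 2 - e 1) / (e 2 - e 0) = (1 - (β - 1) / (α - 1)) + ((f₀ + (β - 1) / (α - 1)) - (f₀ + (e 2 - e 1) / (e 2 - e 0))) by ring,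
      Valuation.map_add_eq_of_lt_left _ hlt, h1g₀]
  obtain ⟨R, hRfin, -, hR1, hR2, hR3⟩ := exists_fixed_class_representatives hσ hvσ hfix hϖ hd ρ 0 hρ
  simp only [Nat.mul_zero, pow_zero, Nat.add_zero] at hR1 hR2 hR3
  rw [finsum_kappaCount_mul_stabiliserWeight_stratum_H_sep_onLocus_foot_eq hD h2 hE hT ρ hρ h12 h13 hρm hm i ℓ k e hk hloc hRfin hR1 hR2 hR3]
  by_cases hout : ((Valued.v (e 0) ≤ Valued.v ϖ ^ ℓ ∧ Valued.v (e 1) ≤ Valued.v ϖ ^ ℓ ∧ Valued.v (e 2) ≤ Valued.v ϖ ^ ℓ) ∧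
      Valued.v (e 1 - e 0) ≤ Valued.v ϖ ^ (ℓ + ρ)) ∧ ℓ + ρ ≤ k
  · rw [if_pos hout, if_pos hout, ← Nat.card_eq_fintype_card]
    have hEeq : ℓ + 2 * ρ = k + (ℓ + 2 * ρ - k) := by omega
    have hball : {g : K | g ∈ R ∧ Valued.v (g + (β - 1) / (α - 1)) ≤ Valued.v ϖ ^ (2 * ρ - n₁) ∧
          Valued.v ϖ ^ k * Valued.v (g + (e 2 - e 1) / (e 2 - e 0)) ≤ Valued.v ϖ ^ (ℓ + 2 * ρ)} =
        {g : K | g ∈ R ∧ Valued.v (g + (β - 1) / (α - 1)) ≤ Valued.v ϖ ^ (2 * ρ - n₁) ∧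
          Valued.v (g + (e 2 - e 1) / (e 2 - e 0)) ≤ Valued.v ϖ ^ (ℓ + 2 * ρ - k)} :=
      Set.ext fun g => and_congr_right fun _ => and_congr_right fun _ => by
        rw [hEeq, pow_mul_le_pow_add_iff hϖ0, Nat.add_sub_cancel_left]
    rw [hball]
    -- nest the two balls around the common witness: the finer one wins
    by_cases hle : 2 * ρ - n₁ ≤ ℓ + 2 * ρ - k
    · have hnest : {g : K | g ∈ R ∧ Valued.v (g + (β - 1) / (α - 1)) ≤ Valued.v ϖ ^ (2 * ρ - n₁) ∧
            Valued.v (g + (e 2 - e 1) / (e 2 - e 0)) ≤ Valued.v ϖ ^ (ℓ + 2 * ρ - k)} =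
          {g : K | g ∈ R ∧ Valued.v (g + (e 2 - e 1) / (e 2 - e 0)) ≤ Valued.v ϖ ^ (ℓ + 2 * ρ - k)} :=
        Set.ext fun g => ⟨fun h => ⟨h.1, h.2.2⟩, fun h => ⟨h.1, ball_of_witness hϖ1.le hf₀ hf₀' hle h.2, h.2⟩⟩
      rw [hnest, max_eq_right hle]
      by_cases hdE : 2 * d - 1 ≤ ℓ + 2 * ρ - k
      · rw [if_pos hdE]
        simp only [if_pos (show 2 * d - 1 ≤ ρ by omega)]
        rw [finsum_chiH_glue_eq_ncard_mul hD hRfin hR1 hge h1ge hdE hσf₀ hf₀' i,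
          ncard_glue_representatives_eq hσ hvσ hfix hϖ hd (by omega) (by omega) hRfin hR1 hR2 hR3 hge hσf₀ hf₀',
          show 2 * ρ - (ℓ + 2 * ρ - k + 1) / 2 = (ρ + 1) / 2 - (ℓ + 2 * ρ - k + 1) / 2 + (ρ + ρ / 2) by omega, pow_add]
        push_cast
        ring
      · rw [if_neg hdE]
        by_cases hdρ : 2 * d - 1 ≤ ρ
        · simp only [if_pos hdρ]
          rw [finsum_chiH_glue_eq_zero hD h2 hdρ hRfin hR1 hR2 hR3 hge h1ge (by omega) (by omega) (by omega) i, zero_mul]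
        · simp only [if_neg hdρ, Int.cast_zero]
          rw [show (∑ᶠ g ∈ {g : K | g ∈ R ∧ Valued.v (g + (e 2 - e 1) / (e 2 - e 0)) ≤ Valued.v ϖ ^ (ℓ + 2 * ρ - k)}, (0 : ℚ)) = 0 by simp, zero_mul]
    · have hle' : ℓ + 2 * ρ - k ≤ 2 * ρ - n₁ := by omega
      have hnest : {g : K | g ∈ R ∧ Valued.v (g + (β - 1) / (α - 1)) ≤ Valued.v ϖ ^ (2 * ρ - n₁) ∧
            Valued.v (g + (e 2 - e 1) / (e 2 - e 0)) ≤ Valued.v ϖ ^ (ℓ + 2 * ρ - k)} =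
          {g : K | g ∈ R ∧ Valued.v (g + (β - 1) / (α - 1)) ≤ Valued.v ϖ ^ (2 * ρ - n₁)} :=
        Set.ext fun g => ⟨fun h => ⟨h.1, h.2.1⟩, fun h => ⟨h.1, h.2, ball_of_witness hϖ1.le hf₀' hf₀ hle' h.2⟩⟩
      rw [hnest, max_eq_left hle']
      by_cases hdE : 2 * d - 1 ≤ 2 * ρ - n₁
      · rw [if_pos hdE]
        simp only [if_pos (show 2 * d - 1 ≤ ρ by omega)]
        rw [finsum_chiH_glue_eq_ncard_mul hD hRfin hR1 hg₀ h1g₀ hdE hσf₀ hf₀ i,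
          ncard_glue_representatives_eq hσ hvσ hfix hϖ hd (by omega) (by omega) hRfin hR1 hR2 hR3 hg₀ hσf₀ hf₀,
          show 2 * ρ - (2 * ρ - n₁ + 1) / 2 = (ρ + 1) / 2 - (2 * ρ - n₁ + 1) / 2 + (ρ + ρ / 2) by omega, pow_add]
        push_cast
        ring
      · rw [if_neg hdE]
        by_cases hdρ : 2 * d - 1 ≤ ρ
        · simp only [if_pos hdρ]
          rw [finsum_chiH_glue_eq_zero hD h2 hdρ hRfin hR1 hR2 hR3 hg₀ h1g₀ (by omega) (by omega) (by omega) i, zero_mul]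
        · simp only [if_neg hdρ, Int.cast_zero]
          rw [show (∑ᶠ g ∈ {g : K | g ∈ R ∧ Valued.v (g + (β - 1) / (α - 1)) ≤ Valued.v ϖ ^ (2 * ρ - n₁)}, (0 : ℚ)) = 0 by simp, zero_mul]
  · rw [if_neg hout, if_neg hout]

/-- **HEAD — LABELLED κ-WEIGHTED H SUM, EQUILATERAL FOOT, GENUINE REGIME, NO FIXED POINT IN BOTH BALLS**: if no `σ`-fixed `f` satisfies both `|f + g₀| ≤ |ϖ|^{2ρ−m}`
and `|f + g_e| ≤ |ϖ|^{ℓ+2ρ−k}` (`k < ℓ + 2ρ`), the index set is empty and the label-cut κ-sum is `0` — in particular for the token of record, whose two centres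
are at distance `1`. [cite: Kottwitz1986BaseChangeUnits, §1 pp. 240–241] [cite: LanglandsShelstad1987, §3] -/
theorem finsum_kappaCount_mul_stabiliserWeight_stratum_H_sep_onLocus_foot_of_no_witness (hD : IsRamifiedQuadraticDatum σ ϖ d t) (h2 : Valued.v (2 : K) < 1)
    (hE : IsElementDatum σ ϖ N₀ α β n₁ n₂ n₃) (hT : (T : Matrix (Fin 3) (Fin 3) K) = Matrix.diagonal ![α, β, 1])
    (ρ : ℕ) (hρ : 1 ≤ ρ) (h12 : n₁ = n₂) (h13 : n₁ = n₃) (hρm : ρ ≤ n₁) (hm : n₁ < 2 * ρ) (i : Fin 3) (ℓ k : ℕ) (e : Fin 3 → K)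
    (hk : Valued.v (e 2 - e 0) = Valued.v ϖ ^ k) (hloc : Valued.v (e 2 - e 1) = Valued.v ϖ ^ k) (hgen : k < ℓ + 2 * ρ)
    (hno : ¬ ∃ f : K, σ f = f ∧ Valued.v (f + (β - 1) / (α - 1)) ≤ Valued.v ϖ ^ (2 * ρ - n₁) ∧
      Valued.v (f + (e 2 - e 1) / (e 2 - e 0)) ≤ Valued.v ϖ ^ (ℓ + 2 * ρ - k)) :
    ∑ᶠ M ∈ {M | M ∈ stratum σ ϖ T ![2 * ρ, 2 * ρ, 2 * ρ] ∧ LatticeInLevel ϖ ℓ (Matrix.diagonal e) M},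
        (kappaCount σ ϖ 0 i M : ℚ) * stabiliserWeight σ M = 0 := by
  classical
  have hσ : ∀ x, σ (σ x) = x := hD.1
  have hvσ : ∀ a, Valued.v (σ a) = Valued.v a := hD.2.1
  have hϖ : Valued.v ϖ = exp (-1 : ℤ) := hD.2.2.1
  have hfix : ∀ x : K, σ x = x → x ≠ 0 → ∃ n : ℤ, Valued.v x = exp (2 * n) := hD.2.2.2.1
  have hd : Valued.v (ϖ - σ ϖ) = Valued.v ϖ ^ d := hD.2.2.2.2.1
  obtain ⟨hϖ0, -⟩ := ne_zero_and_v_lt_one_of_v_eq_exp hϖ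
  obtain ⟨R, hRfin, -, hR1, hR2, hR3⟩ := exists_fixed_class_representatives hσ hvσ hfix hϖ hd ρ 0 hρ
  simp only [Nat.mul_zero, pow_zero, Nat.add_zero] at hR1 hR2 hR3
  rw [finsum_kappaCount_mul_stabiliserWeight_stratum_H_sep_onLocus_foot_eq hD h2 hE hT ρ hρ h12 h13 hρm hm i ℓ k e hk hloc hRfin hR1 hR2 hR3]
  by_cases hout : ((Valued.v (e 0) ≤ Valued.v ϖ ^ ℓ ∧ Valued.v (e 1) ≤ Valued.v ϖ ^ ℓ ∧ Valued.v (e 2) ≤ Valued.v ϖ ^ ℓ) ∧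
      Valued.v (e 1 - e 0) ≤ Valued.v ϖ ^ (ℓ + ρ)) ∧ ℓ + ρ ≤ k
  · rw [if_pos hout]
    have hEeq : ℓ + 2 * ρ = k + (ℓ + 2 * ρ - k) := by omega
    have hemp : {g : K | g ∈ R ∧ Valued.v (g + (β - 1) / (α - 1)) ≤ Valued.v ϖ ^ (2 * ρ - n₁) ∧
        Valued.v ϖ ^ k * Valued.v (g + (e 2 - e 1) / (e 2 - e 0)) ≤ Valued.v ϖ ^ (ℓ + 2 * ρ)} = ∅ :=
      Set.eq_empty_of_forall_notMem fun g ⟨hgR, hg₁, hg⟩ => hno ⟨g, (hR1 g hgR).1, hg₁, by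
        rwa [hEeq, pow_mul_le_pow_add_iff hϖ0] at hg⟩
    rw [hemp, finsum_mem_empty, zero_mul]
  · rw [if_neg hout]

end Summit.HodgeConjecture.HodgeConjecture.Cruxes.H413.F0P3cDyRamLabelledKappaCoreHangingLocusClosed

end
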